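import Summits.CriticalPhenomena.PercolationContinuityZ3.Theorems.PercAnnulusCrossingIICVolumeGrowthDeterministic
import HarnessLib

/-!
# The deterministic lower volume growth rate of Kesten's IIC is finite (lane RSW3, p1 gen 14)

builds on p205010 (kernel theorem, internal audit signed; external expert review pending) — used through `θ(p_c) = 0`
(`CSH.percolationContinuity_allDimensions`, gen 10's tail triviality, p1 gen 7's mean volume bound); the `ℤ²` statement is unconditional.

Seat `prim-rsw3-p1` (gen 14); memo `run/shared/lean/prim/rsw3/P1-QM.md` §27.  Helper file for the crux `stmt-CriticalPhenomena-4575`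
chain; no definitions, no sorries.  `V_n = #{z ∈ Λ(n) : 0 ↔ z}`, `s(n) = (2n+1)^d π_{p_c}(n)`.

By gen 14's `…IICVolumeGrowthDeterministic`, `liminf_n V_n/s(n) = c⁻` and `limsup_n V_n/s(n) = c⁺` a.s. for constants `c^± ∈ [0,∞]`.  FATOU'S
LEMMA and Kesten's (8) in mean (p1 gen 7: `E_ν V_n ≤ C n^d π_{p_c}(n)`) bound the lower rate:

* `lintegral_ofReal_volume_div_le` — `∫⁻ V_n/s(n) dν ≤ C`;
* **`iicMeasure_exists_ae_liminf_volume_eq_const_lt_top`** — at `p_c(ℤ^d)` under (A2)□ at aspect `(s,L)` (`2 ≤ s ≤ L`): the a.s. constant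
  `c⁻ = liminf_n V_n/s(n)` satisfies `c⁻ ≤ C < ∞` — **the deterministic lower volume growth rate of the IIC is finite** (whereas the upper rate is
  `≥ λ > 0` under count tightness, `iicMeasure_exists_ae_limsup_volume_eq_const_pos`); **`…_Z2`** unconditional.

References: H. Kesten, PTRF 73 (1986) Thm. (8); D. Basu, A. Sapozhnikov, ECP 22 (2017) no. 26; H.-O. Georgii (2011), Prop. 7.9.
-/

noncomputable section

namespace Summit.CriticalPhenomena.PercolationContinuityZ3.Theorems.Crossing

open MeasureTheory Filter Topology Literature.Probability.Percolation Literature.Probability.LatticeModels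
open Literature.Probability.Percolation.DCT16 Literature.Probability.Percolation.DKT20
open Summit.CriticalPhenomena.PercolationContinuityZ3.Theorems.SurfaceTension
open scoped Literature.Probability.Percolation ENNReal symmDiff

variable {d : ℕ}

open Classical in
/-- **`∫⁻ V_n/s(n) dν ≤ C`**: the normalised mean volume of the IIC is bounded (`p_c(ℤ^d)`, `d ≥ 2`, (A2)□ at aspect `(s,L)`, `2 ≤ s ≤ L`; p1 gen 7's
`E_ν V_n ≤ C n^d π_{p_c}(n)` and `n^d ≤ (2n+1)^d`). [cite: Kesten1986, Thm. (8)] [cite: BasuSapozhnikov2017ECP, Thm. 1.1] -/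
theorem lintegral_ofReal_volume_div_le (hd : 2 ≤ d) {s L : ℕ} (hs : 2 ≤ s) (hsL : s ≤ L) {ϰ : ℝ} (hϰ : 0 < ϰ)
    (hA2 : SetToSetQuasiMultAspectAt d (criticalProbI d) s L ϰ) :
    ∃ C : ℝ, 0 < C ∧ ∀ (ν : Measure (BondConfig (Site d))) [IsProbabilityMeasure ν],
      (∀ (F : Finset (Sym2 (Site d))) (E : Set (BondConfig (Site d))), MeasurableSet E → DeterminedBy E ↑F →
        Tendsto (fun n : ℕ => (bondPercolation (zdGraph d) (criticalProbI d)).real (E ∩ siteToBoundary d n) /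
          oneArmProb d (criticalProbI d) n) atTop (𝓝 (ν.real E))) →
      ∀ n : ℕ, 1 ≤ n → ∫⁻ ω, ENNReal.ofReal
        (((((box d n).filter fun z => ω ∈ (openConn (0 : Site d) z : Set (BondConfig (Site d)))).card : ℕ) : ℝ) /
          ((2 * (n : ℝ) + 1) ^ d * oneArmProb d (criticalProbI d) n)) ∂ν ≤ ENNReal.ofReal C := by
  have hd1 : 1 ≤ d := by omega
  have hpc : 0 < ((criticalProbI d : unitInterval) : ℝ) := by rw [coe_criticalProbI]; exact criticalProb_zd_pos d hd1
  have hπpos : ∀ n, 0 < oneArmProb d (criticalProbI d) n := fun n =>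
    (pow_pos hpc _).trans_le (DKT20.pow_le_real_siteToBoundary hd1 (criticalProbI d) _)
  obtain ⟨C, hC, hup⟩ := iicMeasure_sum_openConn_le_criticalProbI hd hs hsL hϰ hA2
  refine ⟨C, hC, fun ν _ hν n hn => ?_⟩
  set sN : ℝ := (2 * (n : ℝ) + 1) ^ d * oneArmProb d (criticalProbI d) n with hsN
  have hsNpos : 0 < sN := mul_pos (by positivity) (hπpos n)
  set V : BondConfig (Site d) → ℝ := fun ω =>
    ((((box d n).filter fun z => ω ∈ (openConn (0 : Site d) z : Set (BondConfig (Site d)))).card : ℕ) : ℝ) with hV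
  have hVeq : V = fun ω => ∑ z ∈ box d n, (openConn (0 : Site d) z : Set (BondConfig (Site d))).indicator 1 ω :=
    funext fun ω => Rsw3.card_filter_mem_eq_sum_indicator (box d n) _ ω
  have hind : ∀ z, Integrable ((openConn (0 : Site d) z : Set (BondConfig (Site d))).indicator (1 : BondConfig (Site d) → ℝ)) ν :=
    fun z => (integrable_const (1 : ℝ)).indicator (measurableSet_openConn_holds _ _)
  have hVI : Integrable V ν := by rw [hVeq]; exact integrable_finsetSum _ fun z _ => hind z
  have hV0 : ∀ ω, 0 ≤ V ω := fun ω => Nat.cast_nonneg _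
  have hIV : ∫ ω, V ω ∂ν = ∑ z ∈ box d n, ν.real (openConn (0 : Site d) z) := by
    rw [hVeq, integral_finsetSum _ (fun z _ => hind z)]
    exact Finset.sum_congr rfl fun z _ => integral_indicator_one (measurableSet_openConn_holds _ _)
  have hmean : ∫ ω, V ω / sN ∂ν ≤ C := by
    rw [integral_div, hIV, div_le_iff₀ hsNpos]
    refine (hup ν hν n hn).trans ?_
    rw [hsN, ← mul_assoc]
    refine mul_le_mul_of_nonneg_right (mul_le_mul_of_nonneg_left (pow_le_pow_left₀ (Nat.cast_nonneg n) (by linarith) d) hC.le)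
      (hπpos n).le
  calc ∫⁻ ω, ENNReal.ofReal (V ω / sN) ∂ν = ENNReal.ofReal (∫ ω, V ω / sN ∂ν) :=
        (ofReal_integral_eq_lintegral_ofReal (hVI.div_const _) (Filter.Eventually.of_forall fun ω => div_nonneg (hV0 ω) hsNpos.le)).symm
    _ ≤ ENNReal.ofReal C := ENNReal.ofReal_le_ofReal hmean

open Classical in
/-- **THE DETERMINISTIC LOWER VOLUME GROWTH RATE OF KESTEN'S IIC IS FINITE** (`p_c(ℤ^d)`, `d ≥ 2`, (A2)□ at aspect `(s,L)`, `2 ≤ s ≤ L`, `ϰ > 0`;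
every IIC probability measure `ν`): the a.s. constant `c⁻ = liminf_n #{z ∈ Λ(n) : 0 ↔ z}/((2n+1)^dπ_{p_c}(n))` (gen 14
`iicMeasure_exists_ae_volume_rates_eq_const_criticalProbI`) satisfies `c⁻ ≤ C < ∞`: by FATOU, `c⁻ = ∫⁻ liminf ≤ liminf ∫⁻ V_n/s(n) ≤ C`.
[cite: Kesten1986, Thm. (8)] [cite: BasuSapozhnikov2017ECP, Thm. 1.1] [cite: Georgii2011, Prop. 7.9] -/
theorem iicMeasure_exists_ae_liminf_volume_eq_const_lt_top (hd : 2 ≤ d) {s L : ℕ} (hs : 2 ≤ s) (hsL : s ≤ L) {ϰ : ℝ} (hϰ : 0 < ϰ)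
    (hA2 : SetToSetQuasiMultAspectAt d (criticalProbI d) s L ϰ)
    {ν : Measure (BondConfig (Site d))} [IsProbabilityMeasure ν]
    (hν : ∀ (F : Finset (Sym2 (Site d))) (E : Set (BondConfig (Site d))), MeasurableSet E → DeterminedBy E ↑F →
      Tendsto (fun n : ℕ => (bondPercolation (zdGraph d) (criticalProbI d)).real (E ∩ siteToBoundary d n) /
        oneArmProb d (criticalProbI d) n) atTop (𝓝 (ν.real E))) :
    ∃ c : ℝ≥0∞, c < ⊤ ∧ ∀ᵐ ω ∂ν, liminf (fun n => ENNReal.ofReal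
        (((((box d n).filter fun z => ω ∈ (openConn (0 : Site d) z : Set (BondConfig (Site d)))).card : ℕ) : ℝ) /
          ((2 * (n : ℝ) + 1) ^ d * oneArmProb d (criticalProbI d) n))) atTop = c := by
  obtain ⟨-, ⟨c, hc⟩⟩ := iicMeasure_exists_ae_volume_rates_eq_const_criticalProbI hd hs hϰ hA2 hν
  obtain ⟨C, hC, hmean⟩ := lintegral_ofReal_volume_div_le hd hs hsL hϰ hA2
  refine ⟨c, ?_, hc⟩
  set f : ℕ → BondConfig (Site d) → ℝ≥0∞ := fun n ω => ENNReal.ofReal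
    (((((box d n).filter fun z => ω ∈ (openConn (0 : Site d) z : Set (BondConfig (Site d)))).card : ℕ) : ℝ) /
      ((2 * (n : ℝ) + 1) ^ d * oneArmProb d (criticalProbI d) n)) with hf
  have hfm : ∀ n, Measurable (f n) := fun n => ENNReal.measurable_ofReal.comp
    ((measurable_card_filter_box n fun z => measurableSet_openConn_holds (0 : Site d) z).div_const _)
  -- Fatou
  have hfatou : ∫⁻ ω, liminf (fun n => f n ω) atTop ∂ν ≤ liminf (fun n => ∫⁻ ω, f n ω ∂ν) atTop := lintegral_liminf_le hfm
  have hconst : ∫⁻ ω, liminf (fun n => f n ω) atTop ∂ν = c := by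
    have hae' : (fun ω => liminf (fun n => f n ω) atTop) =ᵐ[ν] fun _ => c := hc.mono fun ω hω => hω
    rw [lintegral_congr_ae hae', lintegral_const, measure_univ, mul_one]
  have hbound : liminf (fun n => ∫⁻ ω, f n ω ∂ν) atTop ≤ ENNReal.ofReal C := by
    refine liminf_le_of_frequently_le' (Filter.Eventually.frequently ?_)
    exact Filter.eventually_atTop.2 ⟨1, fun n hn => hmean ν hν n hn⟩
  calc c = ∫⁻ ω, liminf (fun n => f n ω) atTop ∂ν := hconst.symm
    _ ≤ ENNReal.ofReal C := hfatou.trans hbound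
    _ < ⊤ := ENNReal.ofReal_lt_top

open Classical in
/-- **Kesten's planar IIC, unconditionally: the deterministic lower volume growth rate `liminf_n V_n/((2n+1)²π_{p_c}(n))` is finite.**
[cite: Kesten1986, Thm. (8)] [cite: Georgii2011, Prop. 7.9] -/
theorem iicMeasure_exists_ae_liminf_volume_eq_const_lt_top_Z2 {ν : Measure (BondConfig (Site 2))} [IsProbabilityMeasure ν]
    (hν : ∀ (F : Finset (Sym2 (Site 2))) (E : Set (BondConfig (Site 2))), MeasurableSet E → DeterminedBy E ↑F →
      Tendsto (fun n : ℕ => (bondPercolation (zdGraph 2) (criticalProbI 2)).real (E ∩ siteToBoundary 2 n) /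
        oneArmProb 2 (criticalProbI 2) n) atTop (𝓝 (ν.real E))) :
    ∃ c : ℝ≥0∞, c < ⊤ ∧ ∀ᵐ ω ∂ν, liminf (fun n => ENNReal.ofReal
        (((((box 2 n).filter fun z => ω ∈ (openConn (0 : Site 2) z : Set (BondConfig (Site 2)))).card : ℕ) : ℝ) /
          ((2 * (n : ℝ) + 1) ^ 2 * oneArmProb 2 (criticalProbI 2) n))) atTop = c := by
  obtain ⟨ϰ, hϰ, hA2⟩ := exists_setToSetQuasiMultAspectAt_two_of_criticalProbI_le
  exact iicMeasure_exists_ae_liminf_volume_eq_const_lt_top (d := 2) le_rfl (by norm_num) (by norm_num) hϰ (hA2 _ le_rfl) hν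

end Summit.CriticalPhenomena.PercolationContinuityZ3.Theorems.Crossing

end
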